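import Summits.NavierStokesRegularity.NavierStokesRegularity.Theorems.SqueezeCycleRecurrentLiouvilleGkHarvest
import HarnessLib

/-!
# Route SqueezeCycle — vocabulary posited by line `Sketch` v6 (Giga–Kohn harvest) of the crux
# `RecurrentLiouville` (stmt-NavierStokesRegularity-1589): the scaling defect and the Gaussian scaling action

Definitions, plus the named forms of the landed harvest theorems.  The line measures how fast a
Type-I profile moves along its own Navier–Stokes scaling orbit `c ↦ u_c = c u(c² ·, c ·)` in the
Giga–Kohn metric (strategist census `Cruxes/RecurrentLiouville/STRATEGY-CENSUS.md` §3 S3, workfile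
`Cruxes/RecurrentLiouville/HarvestGigaKohnAction.lean`, where the same two objects are typed with
Bochner integrals and classical partial derivatives; here they are typed ONCE, in the form the landed
theorems use):

* `scalingDefect u (t, x) = ½ u(t,x) + D(uncurry u)(t,x)[(t, x/2)]` — for `u` of class `C¹` on the open
  slab this is `½u + ½(x·∇)u + t∂ₜu = ½ · d/dc|_{c=1} (c u(c²t, cx))` (`= −(−t)^{-1/2}·½∂ₛU` in Leray's
  similarity variables); it vanishes on a window exactly when `u` is self-similar there.  Total
  (junk where `uncurry u` is not differentiable: Mathlib's `fderiv` is `0` there).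
* `gaussScalingAction u t₀ t₁ = ∫⁻_{(t₀,t₁)×ℝ³} ‖scalingDefect u‖ₑ² · K(−t, x)` — the Gaussian SCALING
  ACTION on the backward window `(t₀, t₁)`, `K` the heat kernel, as an extended non-negative real
  (`∫⁻`, so no integrability side condition); scale invariant, `(4π)^{-3/2}∫‖∂ₛU‖²_{L²(ρ)} ds` in
  similarity variables.
* Named harvest: `stationaryWindowRemoval` (∃ η(C,M) > 0: a class member with a `C¹` representative
  whose action on ONE unit window `(4t₀,t₀)` is `≤ η` is regular at the origin), `neverRests` (every
  Type-I singularity model spends action `> η` on EVERY unit window), `neverRests_repr` (read on the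
  Oseen-mild representative) — definitional unfoldings of `gk_stationaryWindowRemoval`,
  `gk_neverRests`, `gk_neverRests_repr` (`Theorems/SqueezeCycleRecurrentLiouvilleGkHarvest.lean`).

Design: plain `def`s over Mathlib/Literature notions only (`fderiv`, `∫⁻`,
`UnboundedOperators.heatKernel`); time first (`u t x`) as everywhere on the summit.  Nothing here
restates a tree notion (`lean search` 2026-08-17: `scalingDefect` / `gaussScalingAction` are declared
only in the crux WORKFILE `Cruxes/RecurrentLiouville/HarvestGigaKohnAction.lean`, namespace
`…Cruxes.RecurrentLiouville.Harvest`, which is not importable from `Theorems/`).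

## References

* Y. Giga, R. V. Kohn, *Asymptotically self-similar blow-up of semilinear heat equations*, Comm. Pure
  Appl. Math. 38 (1985) 297–319, §2 (weighted energy, `dE/ds = −∫ w_s² ρ`). [GigaKohn1985]
* T.-P. Tsai, Arch. Rational Mech. Anal. 143 (1998), Thm 1. [Tsai1998]
-/

noncomputable section

open MeasureTheory Set Function Filter Topology TopologicalSpace Metric
open Literature.Analysis Literature.Analysis.FluidPDE
open scoped NNReal ENNReal

set_option linter.dupNamespace false

namespace Summit.NavierStokesRegularity.NavierStokesRegularity.Theorems

/-- **Scaling defect** `Z u (t,x) = ½ u(t,x) + D(uncurry u)(t,x)[(t, x/2)]` of a space–time field on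
`ℝ × ℝ³` (time first); for `u` of class `C¹` on the open slab,
`½u + ½(x·∇)u + t∂ₜu = ½ d/dc|_{c=1} c u(c²t, cx)`. [cite: GigaKohn1985, §2] -/
def scalingDefect (u : ℝ → EuclideanSpace ℝ (Fin 3) → EuclideanSpace ℝ (Fin 3))
    (z : ℝ × EuclideanSpace ℝ (Fin 3)) : EuclideanSpace ℝ (Fin 3) :=
  (2 : ℝ)⁻¹ • u z.1 z.2 + fderiv ℝ (uncurry u) z (z.1, (2 : ℝ)⁻¹ • z.2)

/-- **Gaussian scaling action** of `u` on the backward window `(t₀, t₁)`: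
`∫⁻_{(t₀,t₁)×ℝ³} ‖Z u(t,x)‖ₑ² K(−t,x)`, `K` the heat kernel (an extended non-negative real).
[cite: GigaKohn1985, §2] -/
def gaussScalingAction (u : ℝ → EuclideanSpace ℝ (Fin 3) → EuclideanSpace ℝ (Fin 3)) (t₀ t₁ : ℝ) :
    ℝ≥0∞ :=
  ∫⁻ z in Ioo t₀ t₁ ×ˢ (univ : Set (EuclideanSpace ℝ (Fin 3))),
    ‖scalingDefect u z‖ₑ ^ 2 * ENNReal.ofReal (UnboundedOperators.heatKernel (-z.1) z.2)

/-- Unfolding `scalingDefect`. -/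
@[simp]
theorem scalingDefect_apply (u : ℝ → EuclideanSpace ℝ (Fin 3) → EuclideanSpace ℝ (Fin 3))
    (z : ℝ × EuclideanSpace ℝ (Fin 3)) :
    scalingDefect u z = (2 : ℝ)⁻¹ • u z.1 z.2 + fderiv ℝ (uncurry u) z (z.1, (2 : ℝ)⁻¹ • z.2) :=
  rfl

/-- Unfolding `gaussScalingAction`. -/
theorem gaussScalingAction_eq (u : ℝ → EuclideanSpace ℝ (Fin 3) → EuclideanSpace ℝ (Fin 3))
    (t₀ t₁ : ℝ) :
    gaussScalingAction u t₀ t₁ =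
      ∫⁻ z in Ioo t₀ t₁ ×ˢ (univ : Set (EuclideanSpace ℝ (Fin 3))),
        ‖(2 : ℝ)⁻¹ • u z.1 z.2 + fderiv ℝ (uncurry u) z (z.1, (2 : ℝ)⁻¹ • z.2)‖ₑ ^ 2 *
          ENNReal.ofReal (UnboundedOperators.heatKernel (-z.1) z.2) :=
  rfl

/-! ### Named harvest theorems -/

/-- **Stationary-window removal** (named form of `gk_stationaryWindowRemoval`): for every rate `C`
and bound `M < ⊤` there is `η > 0` such that a suitable weak solution on `ℝ³ × ℝ₋` with weak
gradient, `𝐈 ≤ M`, the rate and of class `C¹` on the open slab, whose Gaussian scaling action on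
SOME unit similarity window `(4t₀, t₀)` is `≤ η`, is regular at the space–time origin.
[cite: GigaKohn1985, §2; Tsai1998, Thm 1] -/
theorem stationaryWindowRemoval :
    ∀ (C : ℝ) (M : ℝ≥0∞), M < ⊤ → ∃ η : ℝ, 0 < η ∧
      ∀ (u : ℝ → EuclideanSpace ℝ (Fin 3) → EuclideanSpace ℝ (Fin 3))
        (p : ℝ → EuclideanSpace ℝ (Fin 3) → ℝ)
        (G : ℝ → EuclideanSpace ℝ (Fin 3) → EuclideanSpace ℝ (Fin 3) →L[ℝ] EuclideanSpace ℝ (Fin 3)),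
        IsSuitableWeakSolutionOn (slab (EuclideanSpace ℝ (Fin 3)) (Iio 0) isOpen_Iio) 1 0 u p →
        HasWeakSpatialGradientOn (slab (EuclideanSpace ℝ (Fin 3)) (Iio 0) isOpen_Iio) u G →
        typeIBound (Iio (0 : ℝ) ×ˢ univ) u p G ≤ M →
        HasTypeITimeDecay C u →
        ContDiffOn ℝ 1 (uncurry u) (Iio (0 : ℝ) ×ˢ univ) →
        (∃ t₀ : ℝ, t₀ < 0 ∧ gaussScalingAction u (4 * t₀) t₀ ≤ ENNReal.ofReal η) →
        ¬ IsBackwardSingularPoint u 0 :=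
  gk_stationaryWindowRemoval

/-- **Never rests** (named form of `gk_neverRests`): every Type-I singularity model of the class with
a `C¹` representative on the open slab spends Gaussian scaling action `> η(C, M)` on EVERY unit
similarity window `(4t₀, t₀)` — "a Type-I singularity never slows down in similarity variables".
[cite: GigaKohn1985, §2; Tsai1998, Thm 1] -/
theorem neverRests :
    ∀ (C : ℝ) (M : ℝ≥0∞), M < ⊤ → ∃ η : ℝ, 0 < η ∧
      ∀ (u : ℝ → EuclideanSpace ℝ (Fin 3) → EuclideanSpace ℝ (Fin 3))
        (p : ℝ → EuclideanSpace ℝ (Fin 3) → ℝ)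
        (G : ℝ → EuclideanSpace ℝ (Fin 3) → EuclideanSpace ℝ (Fin 3) →L[ℝ] EuclideanSpace ℝ (Fin 3)),
        IsSuitableWeakSolutionOn (slab (EuclideanSpace ℝ (Fin 3)) (Iio 0) isOpen_Iio) 1 0 u p →
        HasWeakSpatialGradientOn (slab (EuclideanSpace ℝ (Fin 3)) (Iio 0) isOpen_Iio) u G →
        typeIBound (Iio (0 : ℝ) ×ˢ univ) u p G ≤ M →
        HasTypeITimeDecay C u →
        ContDiffOn ℝ 1 (uncurry u) (Iio (0 : ℝ) ×ˢ univ) →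
        IsBackwardSingularPoint u 0 →
        ∀ t₀ : ℝ, t₀ < 0 → ENNReal.ofReal η < gaussScalingAction u (4 * t₀) t₀ :=
  gk_neverRests

/-- **Never rests, read on the Oseen-mild representative** (named form of `gk_neverRests_repr`):
the same, for every Type-I singularity model `(u, p, G)` of the class and every Type-I ancient mild
field `v` with `u = v` a.e. on the slab. [cite: GigaKohn1985, §2] -/
theorem neverRests_repr :
    ∀ (C : ℝ) (M : ℝ≥0∞), M < ⊤ → ∃ η : ℝ, 0 < η ∧
      ∀ (u : ℝ → EuclideanSpace ℝ (Fin 3) → EuclideanSpace ℝ (Fin 3))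
        (p : ℝ → EuclideanSpace ℝ (Fin 3) → ℝ)
        (G : ℝ → EuclideanSpace ℝ (Fin 3) → EuclideanSpace ℝ (Fin 3) →L[ℝ] EuclideanSpace ℝ (Fin 3))
        (v : ℝ → EuclideanSpace ℝ (Fin 3) → EuclideanSpace ℝ (Fin 3)),
        IsSuitableWeakSolutionOn (slab (EuclideanSpace ℝ (Fin 3)) (Iio 0) isOpen_Iio) 1 0 u p →
        HasWeakSpatialGradientOn (slab (EuclideanSpace ℝ (Fin 3)) (Iio 0) isOpen_Iio) u G →
        typeIBound (Iio (0 : ℝ) ×ˢ univ) u p G ≤ M →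
        IsBackwardSingularPoint u 0 →
        IsTypeIAncientMild C v →
        (∀ᵐ z ∂(volume.restrict (Iio (0 : ℝ) ×ˢ (univ : Set (EuclideanSpace ℝ (Fin 3))))),
          uncurry u z = uncurry v z) →
        ∀ t₀ : ℝ, t₀ < 0 → ENNReal.ofReal η < gaussScalingAction v (4 * t₀) t₀ :=
  gk_neverRests_repr

/-- **Registered stub** `stub_gkNamedHarvest` (crux stmt-NavierStokesRegularity-1589, line Sketch v6):
`stationaryWindowRemoval ∧ neverRests ∧ neverRests_repr` in the named vocabulary.
[cite: GigaKohn1985, §2] -/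
theorem stub_gkNamedHarvest :
    (∀ (C : ℝ) (M : ℝ≥0∞), M < ⊤ → ∃ η : ℝ, 0 < η ∧
      ∀ (u : ℝ → EuclideanSpace ℝ (Fin 3) → EuclideanSpace ℝ (Fin 3))
        (p : ℝ → EuclideanSpace ℝ (Fin 3) → ℝ)
        (G : ℝ → EuclideanSpace ℝ (Fin 3) → EuclideanSpace ℝ (Fin 3) →L[ℝ] EuclideanSpace ℝ (Fin 3)),
        IsSuitableWeakSolutionOn (slab (EuclideanSpace ℝ (Fin 3)) (Iio 0) isOpen_Iio) 1 0 u p →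
        HasWeakSpatialGradientOn (slab (EuclideanSpace ℝ (Fin 3)) (Iio 0) isOpen_Iio) u G →
        typeIBound (Iio (0 : ℝ) ×ˢ univ) u p G ≤ M →
        HasTypeITimeDecay C u →
        ContDiffOn ℝ 1 (uncurry u) (Iio (0 : ℝ) ×ˢ univ) →
        (∃ t₀ : ℝ, t₀ < 0 ∧ gaussScalingAction u (4 * t₀) t₀ ≤ ENNReal.ofReal η) →
        ¬ IsBackwardSingularPoint u 0) ∧
    (∀ (C : ℝ) (M : ℝ≥0∞), M < ⊤ → ∃ η : ℝ, 0 < η ∧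
      ∀ (u : ℝ → EuclideanSpace ℝ (Fin 3) → EuclideanSpace ℝ (Fin 3))
        (p : ℝ → EuclideanSpace ℝ (Fin 3) → ℝ)
        (G : ℝ → EuclideanSpace ℝ (Fin 3) → EuclideanSpace ℝ (Fin 3) →L[ℝ] EuclideanSpace ℝ (Fin 3)),
        IsSuitableWeakSolutionOn (slab (EuclideanSpace ℝ (Fin 3)) (Iio 0) isOpen_Iio) 1 0 u p →
        HasWeakSpatialGradientOn (slab (EuclideanSpace ℝ (Fin 3)) (Iio 0) isOpen_Iio) u G →
        typeIBound (Iio (0 : ℝ) ×ˢ univ) u p G ≤ M →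
        HasTypeITimeDecay C u →
        ContDiffOn ℝ 1 (uncurry u) (Iio (0 : ℝ) ×ˢ univ) →
        IsBackwardSingularPoint u 0 →
        ∀ t₀ : ℝ, t₀ < 0 → ENNReal.ofReal η < gaussScalingAction u (4 * t₀) t₀) ∧
    (∀ (C : ℝ) (M : ℝ≥0∞), M < ⊤ → ∃ η : ℝ, 0 < η ∧
      ∀ (u : ℝ → EuclideanSpace ℝ (Fin 3) → EuclideanSpace ℝ (Fin 3))
        (p : ℝ → EuclideanSpace ℝ (Fin 3) → ℝ)
        (G : ℝ → EuclideanSpace ℝ (Fin 3) → EuclideanSpace ℝ (Fin 3) →L[ℝ] EuclideanSpace ℝ (Fin 3))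
        (v : ℝ → EuclideanSpace ℝ (Fin 3) → EuclideanSpace ℝ (Fin 3)),
        IsSuitableWeakSolutionOn (slab (EuclideanSpace ℝ (Fin 3)) (Iio 0) isOpen_Iio) 1 0 u p →
        HasWeakSpatialGradientOn (slab (EuclideanSpace ℝ (Fin 3)) (Iio 0) isOpen_Iio) u G →
        typeIBound (Iio (0 : ℝ) ×ˢ univ) u p G ≤ M →
        IsBackwardSingularPoint u 0 →
        IsTypeIAncientMild C v →
        (∀ᵐ z ∂(volume.restrict (Iio (0 : ℝ) ×ˢ (univ : Set (EuclideanSpace ℝ (Fin 3))))),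
          uncurry u z = uncurry v z) →
        ∀ t₀ : ℝ, t₀ < 0 → ENNReal.ofReal η < gaussScalingAction v (4 * t₀) t₀) :=
  ⟨stationaryWindowRemoval, neverRests, neverRests_repr⟩

end Summit.NavierStokesRegularity.NavierStokesRegularity.Theorems

end
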